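import Summits.AtomisticToContinuum.BoseEinsteinCondensation.Theorems.BECThomsonPrincipleGDTransferSeededPlainDirections

/-!
# Route `BECThomsonPrinciple`, crux `GDTransfer` (stmt-AtomisticToContinuum-9482), line `seeded-continuity`:
# stub `stub_plainPairCost`, part 2 — the plain pair: continuity, adjointness, `E₀ ≤ N²L⁻³‖v‖₁`

Support file of the registered stub `stub_plainPairCost`.  For the PLAIN pair of the second Defs file,
`ζ₊ g = plainUp m L n g = N^{-1/2} Σ_i e_n(x_i) P_i g` and `ζ₋ g = plainDown m L n g = N^{-1/2} Σ_i P_i^{(n)} g`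
(directions, `C¹`-regularity and the a-priori budgets are the landed `PlainAlgebra.*` of `…SeededPlainDirections`):
* continuity — `ζ±` map continuous functions to continuous functions (`continuous_plainUp/Down`);
* **adjointness** `⟨f, ζ₊ g⟩ = ⟨ζ₋ f, g⟩` on continuous functions (`inner_plainUp`; slot by slot
  `∫ conj(f) e_n(x_i) P_i g = ∫ conj(P_i^{(n)} f) g`, `Lnss.integral_slot_eq_inner_fourierAvg`);
* the constant trial state: `E₀(N, L) ≤ (N²/L³)‖v‖₁` (`periodicGroundStateEnergy_le_const`, via the slice integral
  `lintegral_cellN_pairPot`), which turns the near-minimiser energy per particle into `O(ρ)`.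
All [folklore] (KennedyLiebShastry1988; arXiv:1211.2778 §2; LSSY2005 App. A).
-/

noncomputable section

open MeasureTheory Filter
open scoped ENNReal NNReal ComplexConjugate

namespace Summit.AtomisticToContinuum.BoseEinsteinCondensation.Cruxes.GDTransfer.Seeded

namespace PlainCost

open Literature.MathematicalPhysics.QuantumManyBody.BoseGas
open Summit.AtomisticToContinuum.BoseEinsteinCondensation.Theorems.GaussianDominationCan.Negative
open Summit.AtomisticToContinuum.BoseEinsteinCondensation.Cruxes.GDTransfer.DysonDressedWitness
open Lnss Bare

variable {m : ℕ} {L : ℝ} {v : ℝ → ℝ≥0∞}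

/-! ## Continuity -/

/-- `ζ₊ g` is continuous for continuous `g`. [folklore] -/
theorem continuous_plainUp (n : Fin 3 → ℤ) {g : Config (m + 1) → ℂ} (hg : Continuous g) :
    Continuous (plainUp m L n g) := by
  unfold plainUp
  exact continuous_const.mul (continuous_finsetSum _ fun i _ =>
    ((continuous_cellWave L n).comp (continuous_apply i)).mul (continuous_cellAvg i hg))

/-- `ζ₋ g` is continuous for continuous `g`. [folklore] -/
theorem continuous_plainDown (n : Fin 3 → ℤ) {g : Config (m + 1) → ℂ} (hg : Continuous g) :
    Continuous (plainDown m L n g) := by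
  unfold plainDown
  exact continuous_const.mul (continuous_sum_fourierAvg n hg)

/-! ## Adjointness `⟨f, ζ₊ g⟩ = ⟨ζ₋ f, g⟩` -/

/-- The KLS scale `N^{-1/2}` is real: `conj c = c`. [folklore] -/
theorem conj_scale (m : ℕ) : conj ((Real.sqrt ((m + 1 : ℕ) : ℝ))⁻¹ : ℂ) = ((Real.sqrt ((m + 1 : ℕ) : ℝ))⁻¹ : ℂ) := by
  rw [← Complex.ofReal_inv, Complex.conj_ofReal]

/-- **`ζ₊` is the adjoint of `ζ₋`** on continuous functions: `∫ conj(f) ζ₊g = ∫ conj(ζ₋f) g` over `cell^N`. [folklore] -/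
theorem inner_plainUp (n : Fin 3 → ℤ) {f g : Config (m + 1) → ℂ} (hf : Continuous f) (hg : Continuous g) :
    ∫ X in cellN (m + 1) L, conj (f X) * plainUp m L n g X =
      ∫ X in cellN (m + 1) L, conj (plainDown m L n f X) * g X := by
  set c : ℂ := ((Real.sqrt ((m + 1 : ℕ) : ℝ))⁻¹ : ℂ) with hc
  have hint : ∀ i ∈ (Finset.univ : Finset (Fin (m + 1))), Integrable
      (fun X => conj (f X) * (cellWave L n (X i) * cellAvg (m + 1) L i g X))
      ((volume : Measure (Config (m + 1))).restrict (cellN (m + 1) L)) := fun i _ =>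
    integrableOn_cellN ((Complex.continuous_conj.comp hf).mul
      (((continuous_cellWave L n).comp (continuous_apply i)).mul (continuous_cellAvg i hg))) L
  have hint' : ∀ i ∈ (Finset.univ : Finset (Fin (m + 1))), Integrable
      (fun X => conj (fourierAvg m L n i f X) * g X)
      ((volume : Measure (Config (m + 1))).restrict (cellN (m + 1) L)) := fun i _ =>
    integrableOn_cellN ((Complex.continuous_conj.comp (continuous_fourierAvg n i hf)).mul hg) L
  calc ∫ X in cellN (m + 1) L, conj (f X) * plainUp m L n g X
      = ∫ X in cellN (m + 1) L, c * ∑ i : Fin (m + 1), conj (f X) *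
          (cellWave L n (X i) * cellAvg (m + 1) L i g X) := by
        refine integral_congr_ae (Eventually.of_forall fun X => ?_)
        simp only [plainUp, Finset.mul_sum]
        exact Finset.sum_congr rfl fun i _ => by ring
    _ = c * ∑ i : Fin (m + 1), ∫ X in cellN (m + 1) L, conj (f X) *
          (cellWave L n (X i) * cellAvg (m + 1) L i g X) := by
        rw [integral_const_mul, integral_finsetSum _ hint]
    _ = c * ∑ i : Fin (m + 1), ∫ X in cellN (m + 1) L, conj (fourierAvg m L n i f X) * g X := by
        congr 1
        exact Finset.sum_congr rfl fun i _ => integral_slot_eq_inner_fourierAvg n i hf hg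
    _ = ∫ X in cellN (m + 1) L, c * ∑ i : Fin (m + 1), conj (fourierAvg m L n i f X) * g X := by
        rw [integral_const_mul, integral_finsetSum _ hint']
    _ = ∫ X in cellN (m + 1) L, conj (plainDown m L n f X) * g X := by
        refine integral_congr_ae (Eventually.of_forall fun X => ?_)
        simp only [plainDown, map_mul, map_sum, conj_scale, Finset.sum_mul, Finset.mul_sum]
        exact Finset.sum_congr rfl fun i _ => by rw [hc]; ring

/-! ## The constant trial state: `E₀ ≤ N² L⁻³ ‖v‖₁` -/

/-- `∫_{cell^{n+1}} v^per(xᵢ - xⱼ) dX = ‖v‖₁ · L^{3n}` for `i ≠ j` (slice integration in `xᵢ`). [folklore] -/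
theorem lintegral_cellN_pairPot (hv : Measurable v) (hL : 0 < L) {i j : Fin (m + 1)} (hij : i ≠ j) :
    ∫⁻ X in cellN (m + 1) L, periodizedPotential v L (X i - X j) =
      (∫⁻ x : Space, v ‖x‖) * (ENNReal.ofReal L ^ 3) ^ m := by
  -- adapted from `Lines/pair-subsolution-removal-energy.lean` (`lintegral_cellN_periodizedPotential_pair_slice`)
  have hH : Measurable fun X : Config (m + 1) => periodizedPotential v L (X i - X j) := measurable_pairPot hv L i j
  have key := lintegral_cellN_lintegral_update (L := L) i hH
  have hinner : ∀ X : Config (m + 1),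
      (∫⁻ x in cell L, periodizedPotential v L (Function.update X i x i - Function.update X i x j)) =
        ∫⁻ y : Space, v ‖y‖ := by
    intro X
    simp only [Function.update_self, Function.update_of_ne hij.symm]
    exact lintegral_cell_periodizedPotential_sub hL hv (X j)
  simp only [hinner] at key
  rw [setLIntegral_const, volume_cellN, pow_succ, ← mul_assoc] at key
  have hV0 : (ENNReal.ofReal L ^ 3) ≠ 0 := pow_ne_zero _ ((ENNReal.ofReal_pos.2 hL).ne')
  have hVt : (ENNReal.ofReal L ^ 3) ≠ ⊤ := ENNReal.pow_ne_top ENNReal.ofReal_ne_top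
  have key' : (ENNReal.ofReal L ^ 3) * ((∫⁻ y : Space, v ‖y‖) * (ENNReal.ofReal L ^ 3) ^ m) =
      (ENNReal.ofReal L ^ 3) * ∫⁻ X in cellN (m + 1) L, periodizedPotential v L (X i - X j) := by
    rw [← key]; ring
  exact ((ENNReal.mul_right_inj hV0 hVt).1 key').symm

/-- **`E₀(n+1, L) ≤ ((n+1)²/L³) ‖v‖₁`** by the constant trial state `Φ ≡ L^{-3(n+1)/2}` (zero kinetic energy;
each of the `≤ (n+1)²` pair terms costs `L⁻³‖v‖₁`). [folklore] -/
theorem periodicGroundStateEnergy_le_const (hv : Measurable v) (m : ℕ) (hL : 0 < L) :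
    periodicGroundStateEnergy v (m + 1) L ≤
      ENNReal.ofReal (((m : ℝ) + 1) ^ 2 / L ^ 3) * ∫⁻ x : Space, v ‖x‖ := by
  -- adapted from `Lines/pair-subsolution-removal-energy.lean` (`periodicGroundStateEnergy_le_const`)
  set Avol : ℝ := (L ^ 3) ^ (m + 1) with hA
  have hL3 : 0 < L ^ 3 := by positivity
  have hApos : 0 < Avol := by positivity
  set c : ℝ := (Real.sqrt Avol)⁻¹ with hcdef
  have hc : ((‖(c : ℂ)‖₊ : ℝ≥0∞) ^ 2) = ENNReal.ofReal Avol⁻¹ := by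
    rw [coe_nnnorm_sq_eq_ofReal, Complex.norm_real, hcdef, norm_inv, Real.norm_of_nonneg (Real.sqrt_nonneg _),
      inv_pow, Real.sq_sqrt hApos.le]
  have hvolA : (ENNReal.ofReal L ^ 3) ^ (m + 1) = ENNReal.ofReal Avol := by
    rw [hA, ← ENNReal.ofReal_pow hL.le, ← ENNReal.ofReal_pow hL3.le]
  let Φ : PeriodicTrialState (m + 1) L :=
    { ψ := fun _ => (c : ℂ)
      contDiff := contDiff_const
      periodic := fun _ _ _ => rfl
      symm := fun _ _ => rfl
      norm_eq := by
        rw [setLIntegral_const, volume_cellN, hc, hvolA, ← ENNReal.ofReal_mul (inv_nonneg.2 hApos.le),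
          inv_mul_cancel₀ hApos.ne', ENNReal.ofReal_one] }
  refine (periodicGroundStateEnergy_le v Φ).trans ?_
  have hkin : ∀ X : Config (m + 1), kineticDensity (fun _ : Config (m + 1) => (c : ℂ)) X = 0 := by
    intro X
    simp [kineticDensity]
  have hE : periodicEnergy v Φ = (∫⁻ X in cellN (m + 1) L, periodicInteraction v L X) * ENNReal.ofReal Avol⁻¹ := by
    unfold periodicEnergy
    rw [← lintegral_mul_const' _ _ ENNReal.ofReal_ne_top]
    refine lintegral_congr fun X => ?_
    change kineticDensity (fun _ : Config (m + 1) => (c : ℂ)) X +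
        periodicInteraction v L X * ((‖(c : ℂ)‖₊ : ℝ≥0∞) ^ 2) = _
    rw [hkin, zero_add, hc]
  set I : ℝ≥0∞ := ∫⁻ x : Space, v ‖x‖ with hI
  set V : ℝ≥0∞ := ENNReal.ofReal L ^ 3 with hV
  have hmeas : ∀ i j : Fin (m + 1), Measurable fun X : Config (m + 1) => periodizedPotential v L (X i - X j) :=
    fun i j => measurable_pairPot hv L i j
  have hint : (∫⁻ X in cellN (m + 1) L, periodicInteraction v L X) ≤
      ((m + 1 : ℕ) : ℝ≥0∞) * (((m + 1 : ℕ) : ℝ≥0∞) * (I * V ^ m)) := by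
    unfold periodicInteraction
    rw [lintegral_finsetSum _ fun i _ => Finset.measurable_sum _ fun j _ => hmeas i j]
    have hrow : ∀ i : Fin (m + 1),
        (∫⁻ X in cellN (m + 1) L, ∑ j : Fin (m + 1) with i < j, periodizedPotential v L (X i - X j)) ≤
          ((m + 1 : ℕ) : ℝ≥0∞) * (I * V ^ m) := by
      intro i
      rw [lintegral_finsetSum _ fun j _ => hmeas i j]
      have hterm : ∀ j ∈ (Finset.univ.filter fun j : Fin (m + 1) => i < j),
          (∫⁻ X in cellN (m + 1) L, periodizedPotential v L (X i - X j)) = I * V ^ m := fun j hj =>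
        lintegral_cellN_pairPot hv hL (Finset.mem_filter.1 hj).2.ne
      rw [Finset.sum_congr rfl hterm, Finset.sum_const, nsmul_eq_mul]
      gcongr
      exact_mod_cast (Finset.card_filter_le _ _).trans (by simp)
    calc (∑ i : Fin (m + 1), ∫⁻ X in cellN (m + 1) L,
            ∑ j : Fin (m + 1) with i < j, periodizedPotential v L (X i - X j))
        ≤ ∑ _i : Fin (m + 1), ((m + 1 : ℕ) : ℝ≥0∞) * (I * V ^ m) := Finset.sum_le_sum fun i _ => hrow i
      _ = ((m + 1 : ℕ) : ℝ≥0∞) * (((m + 1 : ℕ) : ℝ≥0∞) * (I * V ^ m)) := by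
          rw [Finset.sum_const, nsmul_eq_mul, Finset.card_univ, Fintype.card_fin]
  rw [hE]
  calc (∫⁻ X in cellN (m + 1) L, periodicInteraction v L X) * ENNReal.ofReal Avol⁻¹
      ≤ ((m + 1 : ℕ) : ℝ≥0∞) * (((m + 1 : ℕ) : ℝ≥0∞) * (I * V ^ m)) * ENNReal.ofReal Avol⁻¹ :=
        mul_le_mul' hint le_rfl
    _ = (((m + 1 : ℕ) : ℝ≥0∞) * ((m + 1 : ℕ) : ℝ≥0∞) * (V ^ m * ENNReal.ofReal Avol⁻¹)) * I := by ring
    _ = ENNReal.ofReal (((m : ℝ) + 1) ^ 2 / L ^ 3) * I := by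
        congr 1
        rw [hV, ← ENNReal.ofReal_pow hL.le, ← ENNReal.ofReal_pow hL3.le,
          ← ENNReal.ofReal_mul (by positivity), ← ENNReal.ofReal_natCast,
          ← ENNReal.ofReal_mul (by positivity), ← ENNReal.ofReal_mul (by positivity)]
        congr 1
        rw [hA]
        push_cast
        field_simp
        ring

end PlainCost

/-- **Part 2 of `stub_plainPairCost` (registered helper statement)**: the plain creator `ζ₊ = plainUp` is the
`L²(cell^N)`-adjoint of the plain annihilator `ζ₋ = plainDown` on continuous functions. [folklore] -/
theorem plainPairCost_inner_plainUp :
    ∀ (m : ℕ) (L : ℝ) (n : Fin 3 → ℤ)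
      (f g : Literature.MathematicalPhysics.QuantumManyBody.BoseGas.Config (m + 1) → ℂ), Continuous f → Continuous g →
        ∫ X in Literature.MathematicalPhysics.QuantumManyBody.BoseGas.cellN (m + 1) L,
            (starRingEnd ℂ) (f X) * plainUp m L n g X =
          ∫ X in Literature.MathematicalPhysics.QuantumManyBody.BoseGas.cellN (m + 1) L,
            (starRingEnd ℂ) (plainDown m L n f X) * g X :=
  fun _ _ n _ _ hf hg => PlainCost.inner_plainUp n hf hg

end Summit.AtomisticToContinuum.BoseEinsteinCondensation.Cruxes.GDTransfer.Seeded

end
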